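import Mathlib
import HarnessLib
import Summits.NavierStokesRegularity.NavierStokesRegularity.Theorems.UnthreadedRigidityDoorUnthreadedRigidityVirialHornDefs
import Summits.NavierStokesRegularity.NavierStokesRegularity.Theorems.UnthreadedRigidityDoorUnthreadedRigidityProfileHornDefs
import Summits.NavierStokesRegularity.NavierStokesRegularity.Theorems.UnthreadedRigidityDoorUnthreadedRigidityThreadingJetsDefs

/-!
# Route `UnthreadedRigidityDoor`, item `UnthreadedRigidity` (W2, stmt-NavierStokesRegularity-27585) — LINE g12-1 «CO-ZONAL DICHOTOMY»
# (planner ns-idea-6 g12; idea-crit-7 g8 PASS B+, KEY-NS #205): THE TYPED OBJECTS AND STATEMENTS of the line (Theorems-side twin of the sketch)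

Definition file (Theorems-side twin of the files-only line sketch `pub/ideators/ns-idea-6/lines/UnthreadedRigidityDoor/CoZonal_sketch.lean`,
sha16 c7eabdeb25f1685c; namespace `…Theorems.UnthreadedRigidity.CoZonal` instead of the sketch's `…Cruxes.UnthreadedRigidity.CoZonal`; every
def/Prop BODY below is VERBATIM; the sketch already uses the landed VIRIAL/PROFILE HORN and ThreadingJets objects by name (`sepShellL`, `vortAmpL`,
`pbr`, `angForm`, `IsZonalAbout`, `IsSolidHarmonic`, `VirialAdmissible`, `AngularLemma`, `WindowAxisUniform`, `IsSliceAxisymmetric`, `fluxJetOne`),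
so nothing is re-declared; the Theses import is dropped here (the restriction-of-the-crux compositions are in `…CoZonalCompositions.lean`).
Objects: `twoShellL`, `linkAmp`, `IsLinkedPair`, `PoissonCommute`, `IsCoZonal`.  Statements: `TwoShellSliceOrderOneIdentity` (O1₂),
`PbrHomogeneous`, `TwoShellSliceOrderOneLaw`, `WindowOrderOneSilence` (O1-W), `CoZonalLemma` (CZ), `CommutingAngularSilence` (CZ-a),
`ZonalAxesMatch` (CZ-b), `CoZonalShellAxisym` (Z⁺), `LinkedPairWindowRigidity` (residual R), `TwoShellWindowRigidity` (window rung),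
`TwoShellWindowRigidityAll`, `LinkedPairWindowRigidityAll`, `TwoShellSliceDichotomy`, `TwoShellSliceDichotomyAll`.
Filed by engine-1 g71 (DIRECTOR-NS KEY-NS #205); author of the statements: planner ns-idea-6 g12.

WHAT THIS IS NOT: no NS-regularity statement is touched; `UnthreadedRigidity` (27585), W2 and NS regularity stay OPEN; these are the objects of one
RUNG line on the wall item; nobody here claims `UnthreadedRigidity`.  `--supports stmt-NavierStokesRegularity-27585 --as helper`.
[cite: MajdaBertozziCUP2002, §2.1 (Lamb form)]
-/

-- the summit and its single sub-problem share the name (CONVENTIONS §1)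
set_option linter.dupNamespace false

namespace Summit.NavierStokesRegularity.NavierStokesRegularity.Theorems.UnthreadedRigidity.CoZonal

open Summit.NavierStokesRegularity.NavierStokesRegularity.Theorems.UnthreadedRigidity.VirialHorn
open Summit.NavierStokesRegularity.NavierStokesRegularity.Theorems.UnthreadedRigidity.ProfileHorn (E3 IsSliceAxisymmetric)
open Summit.NavierStokesRegularity.NavierStokesRegularity.Theorems.UnthreadedRigidity.ThreadingJets (fluxJetOne)

/-! ## §1 Objects -/

/-- the TWO-SHELL slice about `x₀`: `curl curl (H₁(|y|)Y₁(y) y) + curl curl (H₂(|y|)Y₂(y) y)`, `y = x − x₀`. -/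
noncomputable def twoShellL (H₁ H₂ : ℝ → ℝ) (Y₁ Y₂ : E3 → ℝ) (x₀ : E3) : E3 → E3 :=
  fun x => sepShellL H₁ Y₁ x₀ x + sepShellL H₂ Y₂ x₀ x

/-- the LINK AMPLITUDE `Λ(r) = l₂(l₂+1) H₂ K₁ − l₁(l₁+1) H₁ K₂`, `Kᵢ = vortAmpL lᵢ Hᵢ` (coefficient of `{Y₁,Y₂}` in the first jet). -/
noncomputable def linkAmp (l₁ l₂ : ℕ) (H₁ H₂ : ℝ → ℝ) (r : ℝ) : ℝ :=
  (l₂ : ℝ) * ((l₂ : ℝ) + 1) * H₂ r * vortAmpL l₁ H₁ r - (l₁ : ℝ) * ((l₁ : ℝ) + 1) * H₁ r * vortAmpL l₂ H₂ r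

/-- LINKED profiles: `Λ ≡ 0` on `(0,∞)` (for `(l₁,l₂) = (1,2)`: `H₁K₂ = 3H₂K₁`, g11-2's linkage law). -/
def IsLinkedPair (l₁ l₂ : ℕ) (H₁ H₂ : ℝ → ℝ) : Prop := ∀ r : ℝ, 0 < r → linkAmp l₁ l₂ H₁ H₂ r = 0

/-- Poisson-commuting angular parts: `{Y₁,Y₂} = det[y,∇Y₁,∇Y₂] ≡ 0`. -/
def PoissonCommute (Y₁ Y₂ : E3 → ℝ) : Prop := ∀ y : E3, pbr Y₁ Y₂ y = 0

/-- CO-ZONAL angular parts: zonal about ONE common axis `a ≠ 0`. -/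
def IsCoZonal (Y₁ Y₂ : E3 → ℝ) : Prop := ∃ a : E3, a ≠ 0 ∧ IsZonalAbout a Y₁ ∧ IsZonalAbout a Y₂

/-! ## §2 Obligations (bridges / supports / residual) -/

/-- BRIDGE O1₂ (L-part, size M; explicit-field identity, exact-arithmetic certified on three degree pairs): the first threading jet of a
two-shell is `Λ(|y|)·{Y₁,Y₂}(y)`.  Why it might fail: only by a slip in constants — the `(1,2)` case reproduces the lineage's `H₁K₂ = 3H₂K₁`. -/
def TwoShellSliceOrderOneIdentity : Prop :=
  ∀ (l₁ l₂ : ℕ) (H₁ H₂ : ℝ → ℝ) (Y₁ Y₂ : E3 → ℝ) (x₀ : E3), 1 ≤ l₁ → 1 ≤ l₂ →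
    IsSolidHarmonic l₁ Y₁ → IsSolidHarmonic l₂ Y₂ → VirialAdmissible l₁ H₁ → VirialAdmissible l₂ H₂ →
    ∀ y : E3, y ≠ 0 →
      fluxJetOne (twoShellL H₁ H₂ Y₁ Y₂ x₀) x₀ (x₀ + y) = linkAmp l₁ l₂ H₁ H₂ ‖y‖ * pbr Y₁ Y₂ y

/-- SUPPORT (S): the bracket of solid harmonics of degrees `l₁, l₂ ≥ 1` is homogeneous of degree `l₁ + l₂ − 1`. -/
def PbrHomogeneous : Prop :=
  ∀ (l₁ l₂ : ℕ) (Y₁ Y₂ : E3 → ℝ), 1 ≤ l₁ → 1 ≤ l₂ → IsSolidHarmonic l₁ Y₁ → IsSolidHarmonic l₂ Y₂ →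
    ∀ (c : ℝ) (y : E3), 0 < c → pbr Y₁ Y₂ (c • y) = c ^ (l₁ + l₂ - 1) * pbr Y₁ Y₂ y

/-- BRIDGE O1₂ in DICHOTOMY FORM (what the window composition consumes): order-one silence of a two-shell ⇒ `{Y₁,Y₂} ≡ 0 ∨ Λ ≡ 0`.
Derived below from the identity + homogeneity (`twoShellSliceOrderOneLaw_of_identity`). -/
def TwoShellSliceOrderOneLaw : Prop :=
  ∀ (l₁ l₂ : ℕ) (H₁ H₂ : ℝ → ℝ) (Y₁ Y₂ : E3 → ℝ) (x₀ : E3), 1 ≤ l₁ → 1 ≤ l₂ →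
    IsSolidHarmonic l₁ Y₁ → IsSolidHarmonic l₂ Y₂ → VirialAdmissible l₁ H₁ → VirialAdmissible l₂ H₂ →
    (∀ x : E3, fluxJetOne (twoShellL H₁ H₂ Y₁ Y₂ x₀) x₀ x = 0) →
      PoissonCommute Y₁ Y₂ ∨ IsLinkedPair l₁ l₂ H₁ H₂

/-- BRIDGE O1-W «WINDOW ORDER-ONE SILENCE» (M; the bookkeeping of `virialWindowSilence_of_sliceLaw` ONE ORDER LOWER and with NO pressure
gauge — `curl ∇p = 0`): at every interior time of an unthreaded window (hypotheses of 27585 verbatim, preconnectedness not needed) the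
formal first jet `fluxJetOne (u t) x₀` vanishes identically (interior smoothness `window_smooth_strip`, a classical pressure on a strip,
`derivWithin_threadingFlux_Ici_eq_fluxJetOne`, and `F ≡ 0` on the open set `S`). -/
def WindowOrderOneSilence : Prop :=
  ∀ (S : Set ℝ), IsOpen S → ∀ (u : ℝ → E3 → E3) (x₀ : E3),
    ContinuousOn (Function.uncurry u) (S ×ˢ Set.univ) →
    (∀ t ∈ S, Literature.Analysis.FluidPDE.VectorCalculus.IsDivFree (u t)) →
    (∀ s ∈ S, ∀ t ∈ S, s < t → ∀ x, u t x =
        Literature.Analysis.UnboundedOperators.heatExtension (u s) (t - s) x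
          - Literature.Analysis.FluidPDE.oseenDuhamel 1 s u u t x) →
    (∀ τ ∈ S, ∃ B : ℝ, ∀ t ∈ S, t ≤ τ → ∀ x, ‖u t x‖ ≤ B) →
    (∀ t ∈ S, ∀ x, inner ℝ (Literature.Analysis.FluidPDE.curl (u t) x) (x - x₀) = 0) →
    ∀ t ∈ S, ∀ x, fluxJetOne (u t) x₀ x = 0

/-- SUPPORT CZ «CO-ZONAL LEMMA» (S–M; NEW): nonzero solid harmonics of DIFFERENT degrees `≥ 1` that Poisson-commute are zonal about a
common axis.  Why it might fail: it does not for `l₁ = l₂` (excluded); for `l₁ ≠ l₂` the exact kernel computation (degrees ≤ 6) agrees. -/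
def CoZonalLemma : Prop :=
  ∀ (l₁ l₂ : ℕ) (Y₁ Y₂ : E3 → ℝ), 1 ≤ l₁ → 1 ≤ l₂ → l₁ ≠ l₂ → IsSolidHarmonic l₁ Y₁ → IsSolidHarmonic l₂ Y₂ →
    (∃ y, Y₁ y ≠ 0) → (∃ y, Y₂ y ≠ 0) → PoissonCommute Y₁ Y₂ → IsCoZonal Y₁ Y₂

/-- SUPPORT CZ-a «COMMUTING ⇒ ANGULAR SILENCE» (S; the functional-dependence step of CZ): `{Y₁,Y₂} ≡ 0` with `l₁ ≠ l₂`, `Y₂ ≢ 0`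
forces the angular form `𝒜(Y₁) = {Y₁, |∇Y₁|²}` to vanish (so S-C `AngularLemma` applies to `Y₁`). -/
def CommutingAngularSilence : Prop :=
  ∀ (l₁ l₂ : ℕ) (Y₁ Y₂ : E3 → ℝ), 1 ≤ l₁ → 1 ≤ l₂ → l₁ ≠ l₂ → IsSolidHarmonic l₁ Y₁ → IsSolidHarmonic l₂ Y₂ →
    (∃ y, Y₂ y ≠ 0) → PoissonCommute Y₁ Y₂ → ∀ y, angForm Y₁ y = 0

/-- SUPPORT CZ-b «AXES MATCH» (S): two nonzero zonal harmonics (axes `a`, `b`) that Poisson-commute share the axis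
(`{P(a·y), R(b·y)} = P′R′ det[y,a,b]`). -/
def ZonalAxesMatch : Prop :=
  ∀ (l₁ l₂ : ℕ) (Y₁ Y₂ : E3 → ℝ) (a b : E3), 1 ≤ l₁ → 1 ≤ l₂ → IsSolidHarmonic l₁ Y₁ → IsSolidHarmonic l₂ Y₂ →
    (∃ y, Y₁ y ≠ 0) → (∃ y, Y₂ y ≠ 0) → a ≠ 0 → b ≠ 0 → IsZonalAbout a Y₁ → IsZonalAbout b Y₂ →
    PoissonCommute Y₁ Y₂ → IsZonalAbout a Y₂

/-- SUPPORT Z⁺ «CO-ZONAL TWO-SHELLS ARE AXISYMMETRIC» (S; S-Z `zonalShellAxisym_holds` with the axis NAMED, summed): -/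
def CoZonalShellAxisym : Prop :=
  ∀ (l₁ l₂ : ℕ) (H₁ H₂ : ℝ → ℝ) (Y₁ Y₂ : E3 → ℝ) (x₀ : E3), IsSolidHarmonic l₁ Y₁ → IsSolidHarmonic l₂ Y₂ →
    VirialAdmissible l₁ H₁ → VirialAdmissible l₂ H₂ → IsCoZonal Y₁ Y₂ →
    IsSliceAxisymmetric (twoShellL H₁ H₂ Y₁ Y₂ x₀) x₀

/-- RESIDUAL R «LINKED-PAIR WINDOW RIGIDITY» at degrees `(l₁,l₂)` (the crux RESTRICTED to windows of NON-co-zonal two-shells whose profiles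
are linked at every time; `(1,2)` = g11-2 MIXED PAIR's sector, `l₁,l₂ ≥ 2` OPEN — order two is the next instrument). -/
def LinkedPairWindowRigidity (l₁ l₂ : ℕ) : Prop :=
  ∀ (S : Set ℝ), IsOpen S → IsPreconnected S → ∀ (u : ℝ → E3 → E3) (x₀ : E3),
    ContinuousOn (Function.uncurry u) (S ×ˢ Set.univ) →
    (∀ t ∈ S, Literature.Analysis.FluidPDE.VectorCalculus.IsDivFree (u t)) →
    (∀ s ∈ S, ∀ t ∈ S, s < t → ∀ x, u t x =
        Literature.Analysis.UnboundedOperators.heatExtension (u s) (t - s) x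
          - Literature.Analysis.FluidPDE.oseenDuhamel 1 s u u t x) →
    (∀ τ ∈ S, ∃ B : ℝ, ∀ t ∈ S, t ≤ τ → ∀ x, ‖u t x‖ ≤ B) →
    (∀ t ∈ S, ∀ x, inner ℝ (Literature.Analysis.FluidPDE.curl (u t) x) (x - x₀) = 0) →
    ∀ (Y₁ Y₂ : E3 → ℝ) (H₁f H₂f : ℝ → ℝ → ℝ),
      IsSolidHarmonic l₁ Y₁ → IsSolidHarmonic l₂ Y₂ → (∃ y, Y₁ y ≠ 0) → (∃ y, Y₂ y ≠ 0) → ¬ IsCoZonal Y₁ Y₂ →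
      (∀ t ∈ S, VirialAdmissible l₁ (H₁f t)) → (∀ t ∈ S, VirialAdmissible l₂ (H₂f t)) →
      (∀ t ∈ S, u t = twoShellL (H₁f t) (H₂f t) Y₁ Y₂ x₀) →
      (∀ t ∈ S, IsLinkedPair l₁ l₂ (H₁f t) (H₂f t)) →
      ∃ A : E3 →L[ℝ] E3, (∀ x, inner ℝ (A x) x = 0) ∧ A ≠ 0 ∧
        ∀ t ∈ S, ∀ x, fderiv ℝ (u t) x (A (x - x₀)) - A (u t x) = 0

/-! ## §3 The rung and its compositions -/

/-- RUNG «TWO-SHELL WINDOW RIGIDITY» at degrees `(l₁,l₂)`: the crux `UnthreadedRigidity` (27585) RESTRICTED to windows whose slices are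
two-shells over fixed nonzero solid harmonics `Y₁, Y₂` with admissible time-dependent profiles. -/
def TwoShellWindowRigidity (l₁ l₂ : ℕ) : Prop :=
  ∀ (S : Set ℝ), IsOpen S → IsPreconnected S → ∀ (u : ℝ → E3 → E3) (x₀ : E3),
    ContinuousOn (Function.uncurry u) (S ×ˢ Set.univ) →
    (∀ t ∈ S, Literature.Analysis.FluidPDE.VectorCalculus.IsDivFree (u t)) →
    (∀ s ∈ S, ∀ t ∈ S, s < t → ∀ x, u t x =
        Literature.Analysis.UnboundedOperators.heatExtension (u s) (t - s) x
          - Literature.Analysis.FluidPDE.oseenDuhamel 1 s u u t x) →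
    (∀ τ ∈ S, ∃ B : ℝ, ∀ t ∈ S, t ≤ τ → ∀ x, ‖u t x‖ ≤ B) →
    (∀ t ∈ S, ∀ x, inner ℝ (Literature.Analysis.FluidPDE.curl (u t) x) (x - x₀) = 0) →
    ∀ (Y₁ Y₂ : E3 → ℝ) (H₁f H₂f : ℝ → ℝ → ℝ),
      IsSolidHarmonic l₁ Y₁ → IsSolidHarmonic l₂ Y₂ → (∃ y, Y₁ y ≠ 0) → (∃ y, Y₂ y ≠ 0) →
      (∀ t ∈ S, VirialAdmissible l₁ (H₁f t)) → (∀ t ∈ S, VirialAdmissible l₂ (H₂f t)) →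
      (∀ t ∈ S, u t = twoShellL (H₁f t) (H₂f t) Y₁ Y₂ x₀) →
      ∃ A : E3 →L[ℝ] E3, (∀ x, inner ℝ (A x) x = 0) ∧ A ≠ 0 ∧
        ∀ t ∈ S, ∀ x, fderiv ℝ (u t) x (A (x - x₀)) - A (u t x) = 0

/-- all degree pairs at once (the closed Prop probed by BC7). -/
def TwoShellWindowRigidityAll : Prop :=
  ∀ l₁ l₂ : ℕ, 1 ≤ l₁ → 1 ≤ l₂ → l₁ ≠ l₂ → TwoShellWindowRigidity l₁ l₂

/-- the residual at all degree pairs (closed Prop probed by BC7). -/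
def LinkedPairWindowRigidityAll : Prop :=
  ∀ l₁ l₂ : ℕ, 1 ≤ l₁ → 1 ≤ l₂ → l₁ ≠ l₂ → LinkedPairWindowRigidity l₁ l₂

/-- SLICE DICHOTOMY at degrees `(l₁,l₂)` — the line's NON-HYPOTHETICAL content (a statement about DATA at one time, no window, no flow):
for two-shell data over nonzero solid harmonics of different degrees, ORDER-ONE SILENCE of the threading flux about `x₀` forces
«axisymmetric about `x₀`» OR «linked profiles».  (The WINDOW rung above additionally assumes the two-shell SHAPE at every time of a window — a
hypothetical class, cf. LINE g12-2 «flow-invariant enemies» on which slice classes the Navier–Stokes flow can preserve at all.) -/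
def TwoShellSliceDichotomy (l₁ l₂ : ℕ) : Prop :=
  ∀ (H₁ H₂ : ℝ → ℝ) (Y₁ Y₂ : E3 → ℝ) (x₀ : E3),
    IsSolidHarmonic l₁ Y₁ → IsSolidHarmonic l₂ Y₂ → (∃ y, Y₁ y ≠ 0) → (∃ y, Y₂ y ≠ 0) →
    VirialAdmissible l₁ H₁ → VirialAdmissible l₂ H₂ →
    (∀ x : E3, fluxJetOne (twoShellL H₁ H₂ Y₁ Y₂ x₀) x₀ x = 0) →
      IsSliceAxisymmetric (twoShellL H₁ H₂ Y₁ Y₂ x₀) x₀ ∨ IsLinkedPair l₁ l₂ H₁ H₂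

/-- all pairs (closed Prop probed by BC7). -/
def TwoShellSliceDichotomyAll : Prop :=
  ∀ l₁ l₂ : ℕ, 1 ≤ l₁ → 1 ≤ l₂ → l₁ ≠ l₂ → TwoShellSliceDichotomy l₁ l₂

end Summit.NavierStokesRegularity.NavierStokesRegularity.Theorems.UnthreadedRigidity.CoZonal
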